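import Mathlib
import HarnessLib
import HarnessLib.Audit
import Summits.AtomisticToContinuum.Statement
import Literature.Dynamics.Billiards.SlavedUnstablePlaques
import Literature.MathematicalPhysics.KineticTheory.RegularStationaryState
import Literature.Barriers.AtomisticToContinuum.HighMomentumCutoff
import HarnessLib.Audit.Status.Attr

/-!
Route: UGibbsSRBRigidity

DORMANT since 2026-08-24T00:19:01Z (reconciler: no traction for 6.4 d (last activity item-evidence-added at 2026-08-17T14:51:42Z); parked, not closed — `ledger route dormant route-AtomisticToContinuum-UGibbsSRBRigidity --off` to reactiv) — unstaffed, not closed; items shared with open routes are served there. `ledger route dormant <id> --off` reactivates.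

# Route UGibbsSRBRigidity — u-Gibbs (SRB-class) rigidity for the Boltzmann hypothesis — conforming
re-open of UGibbsRigidity deciding _root_.HydrodynamicLimit

X_u = U1 ∧ U2 ("it suffices to show"), realising card pesin-defect-u-gibbs-rigidity (spine) with
pesin-defect-prices-u-regularity as the foreseen
layer-2 split of U1. U1 (URegularLimitsSlaved, INHERITANCE; repaired 2026-08-15 after crux attacks
on the first filing URegularLimits, whose clause 'local limits carry
the Euler parameters at the zoom point' was misstated and is dropped with all Euler data; re-filed
2026-08-15 23:40Z over the contact-slaved plaque functor D5, see U2): for all local Gibbs profiles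
there is σ₀ such that for
σ < σ₀, all flows Φ_N and all T₀ > 0, every OVY LIMIT STATE (vague cluster point as N → ∞ of the
space–time averaged laws Q^{ε_N} of the configuration
blown up by ε_N⁻¹ around a UNIFORMLY chosen point of 𝕋³, OllaVaradhanYau1993 (4.1); tree notion
IsOVYLimitState) is a translation-invariant probability
law of finite density and kinetic energy, stationary under an equilibrium, translation-covariant
infinite hard-sphere flow Φ∞ (Alexander1976) defined on it with Sinai short-window collision
clusters a.s. (the pins U2 consumes), and u-REGULAR:
its conditional measures on the local unstable plaques of Φ∞ are absolutely continuous (the SRB /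
u-Gibbs property of PesinSinai1982,
LedrappierYoung1985), the plaque family being the route-posited object defn-SlavedUnstablePlaques
(D5, CONTACT-SLAVED window plaques with consistency, locality,
no-atom, teeth and no-ghost-recoil lemmas; it re-poses D4 defn-InfiniteUnstablePlaques, whose
exterior held to the recorded movie incl. its
clock-triggered recoils off window particles puts the recorded orbit on a discontinuity at every
exterior contact, so that every plaque is
leaf-null and NO probability law is u-regular — crux attack on URigidityR2, 2026-08-15T23:15Z). U2
(URigiditySlaved, RIGIDITY; repaired three times 2026-08-15 after crux attacks: the first filing
URigidity had an inert density threshold —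
the hypothesis class was convex — and an unbound plaque family/flow; the second, URigidityR, pinned
the flow by finite collision clusters over ALL
bounded windows, a property no collisional stationary state has — the collision graph percolates
over a few mean free times — replaced by
Sinai's SHORT-WINDOW cluster property; the third, URigidityR2, was VACUOUSLY TRUE because the
u-regular class of the landed D4 functor is empty
(ghost recoils) — now re-filed verbatim over D5's functor L′,
Sketch.uRigidityWith_infiniteUnstablePlaques_iff = Iff.rfl): there is η₀ > 0 such that for every
equilibrium, translation-covariant
infinite hard-sphere flow Φ, every translation-invariant, Φ-stationary (Φ a.e. defined; for some δ >
0 a.s. all collision clusters over all time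
windows of length δ finite, DobrushinSinaiSukhov1989 §4.1, Sinai1974) probability law that is
ERGODIC FOR THE JOINT SPACE–TIME ACTION of translations and Φ, has density in (0, η₀) and finite
kinetic-energy density, and is u-regular for the
same posited plaque functor ((L′ 1 Φ).IsURegular), is a mixture of the hard-sphere Gibbs states
g_{z,u,β} (GronwallU applies it to the joint-ergodic
components of the U1 limit states). U1 ∧ U2 is OllaVaradhanYau1993's missing "strong ergodic
theorem" restricted to the class the dynamics cannot leave; fed into the
unchanged relative-entropy architecture it yields the typed target — since the route-repair of
2026-08-16 that followed the Statement re-type p126922 (the conjunct `_root_.HydrodynamicLimit` is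
now the PACKING-GUARDED limit: ∃ η₀ outermost, guard ∀ t ∈ [0,T) ∀ x, ρ_t(x)σ³ < η₀ after the
solution hypothesis) the GUARDED Yau target RelEntropyVanishingInBand (the shared
stmt-AtomisticToContinuum-0766 with the Statement's guard inserted at the Statement's position and ∃
η₀ prefixed; the canonical signature of the sibling entropy routes, stmt-AtomisticToContinuum-17396;
0766 ⇒ it) — and the conjunct.
This is the CONFORMING RE-OPEN (D-0027 §2.1) of route UGibbsRigidity, retired `not-a-thesis` by the
2026-08-15 audit because its assembly
concluded the Literature decl rather than the sub-problem Statement: here the deciding theorem is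
`closes : URegularLimitsSlaved → URigiditySlaved → GaussianTails → GronwallUInBand →
EntropyMethodTransferInBand → _root_.HydrodynamicLimit` (pure logic, sorry-free), with the guarded
entropy-inequality transfer filed as its own item.
Since the route-choice repair of 2026-08-16 every item is TYPED: U1, U2 and the sanity support over
the landed contact-slaved functor Literature.Dynamics.Billiards.slavedUnstablePlaques (D5), the glue
GronwallUInBand as `URegularLimitsSlaved → URigiditySlaved → GaussianTails →
RelEntropyVanishingInBand` (the item that concludes the guarded target; until the 2026-08-16
statement re-type it was GronwallU stmt-14511 concluding the unguarded 0766, transferred by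
EntropyMethodTransfer stmt-9240 — the three are replaced 1:1 by their in-band forms, each old
statement implying the new one, planner Sketch.lean rc 0), and the large-velocity a-priori bound of
the entropy method with the true kinetic energy as its own crux GaussianTails (Nachtergaele–Yau II.1
in the smooth regime, N-uniform). The further typed cruxes are the three N-UNIFORM finite-N inputs
on which U1/U2 stand or fall: tempered (non-grazing) collision statistics and second moments of
collision counts along the evolved law, and positive dynamical entropy per particle per collision.
Lean: `∃ η₀ : ℝ, 0 < η₀ ∧ ∀ (a₀ θ₀ : Literature.MathematicalPhysics.KineticTheory.T3 → ℝ) (u₀ :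
Literature.MathematicalPhysics.KineticTheory.T3 → Literature.MathematicalPhysics.KineticTheory.V3),
Continuous a₀ → Continuous θ₀ → Continuous u₀ → (∀ x, 0 < a₀ x) → (∀ x, 0 < θ₀ x) → ∃ σ₀ : ℝ, 0 < σ₀
∧ ∀ σ : ℝ, 0 < σ → σ < σ₀ → ∀ (T : ℝ) (ρ θ : ℝ → Literature.MathematicalPhysics.KineticTheory.T3 →
ℝ) (u : ℝ → Literature.MathematicalPhysics.KineticTheory.T3 →
Literature.MathematicalPhysics.KineticTheory.V3),
Literature.MathematicalPhysics.KineticTheory.IsHardSphereEulerSolution σ T ρ u θ → (∀ t ∈ Set.Ico 0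
T, ∀ x, ρ t x * σ ^ 3 < η₀) → ∀ Φ : (N : ℕ) → Literature.Analysis.FluidPDE.HardSphereFlow
(Literature.Analysis.FluidPDE.Torus.geometry (Fin 3))
(Literature.MathematicalPhysics.KineticTheory.hsDiameter σ N) (N + 1), (∀ N,
MeasureTheory.IsProbabilityMeasure (Literature.MathematicalPhysics.KineticTheory.localGibbsLaw σ a₀
u₀ θ₀ N (Φ N))) ∧ (Literature.MathematicalPhysics.KineticTheory.TendstoHydroFieldsAt (fun N =>
Literature.MathematicalPhysics.KineticTheory.localGibbsLaw σ a₀ u₀ θ₀ N (Φ N)) Φ ρ u θ 0 → ∀ t ∈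
Set.Ico 0 T, ∃ a : Literature.MathematicalPhysics.KineticTheory.T3 → ℝ, (∀ N,
MeasureTheory.IsProbabilityMeasure (Literature.MathematicalPhysics.KineticTheory.localGibbsLaw σ a
(u t) (θ t) N (Φ N))) ∧ (∀ χ : Literature.MathematicalPhysics.KineticTheory.T3 → ℝ, Continuous χ → ∀
δ : ℝ, 0 < δ → ∃ C : ℝ, 0 < C ∧ ∀ N : ℕ, Literature.MathematicalPhysics.KineticTheory.localGibbsLaw
σ a (u t) (θ t) N (Φ N) {z | δ < |Literature.MathematicalPhysics.KineticTheory.empiricalDensityField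
z χ - ∫ x, χ x * ρ t x|} ≤ ENNReal.ofReal (C * Real.exp (-(C⁻¹ * (N + 1)))) ∧
Literature.MathematicalPhysics.KineticTheory.localGibbsLaw σ a (u t) (θ t) N (Φ N) {z | δ <
‖Literature.MathematicalPhysics.KineticTheory.empiricalMomentumField z χ - ∫ x, (χ x * ρ t x) • u t
x‖} ≤ ENNReal.ofReal (C * Real.exp (-(C⁻¹ * (N + 1)))) ∧
Literature.MathematicalPhysics.KineticTheory.localGibbsLaw σ a (u t) (θ t) N (Φ N) {z | δ <
|Literature.MathematicalPhysics.KineticTheory.empiricalEnergyField z χ - ∫ x, χ x *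
Literature.MathematicalPhysics.KineticTheory.totalEnergyDensity (ρ t x) (u t x) (θ t x)|} ≤
ENNReal.ofReal (C * Real.exp (-(C⁻¹ * (N + 1))))) ∧ Filter.Tendsto (fun N : ℕ =>
InformationTheory.klDiv ((Φ N).lawAt (Literature.MathematicalPhysics.KineticTheory.localGibbsLaw σ
a₀ u₀ θ₀ N (Φ N)) t) (Literature.MathematicalPhysics.KineticTheory.localGibbsLaw σ a (u t) (θ t) N
(Φ N)) / ((N : ENNReal) + 1)) Filter.atTop (nhds 0))`

## Assembly
U1 (URegularLimitsSlaved) → U2 (URigiditySlaved) → GaussianTails → GronwallUInBand (typed glue, CRUX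
by the hypotheses rule: OVY93 one-block/two-block for the deterministic torus dynamics with the
ergodic input applied ONLY to dynamical local limits, which U1 places in the u-regular class and U2
classifies after descent to joint-ergodic components; Nachtergaele–Yau truncation of the cubic
energy current paid by GaussianTails; virial/EOS identification and reference concentration inside,
the Euler solution confined to the packing band ρσ³ < η₀ where the virial EOS is analytic and
invertible) → RelEntropyVanishingInBand (the GUARDED TARGET, derived) → EntropyMethodTransferInBand
(guarded entropy dock, CRUX by the hypotheses rule, provable now: planner
Sketch.entropyMethodTransferInBand_proof rc 0 over Theorems.tendstoHydroFieldsAt_of_klDiv) →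
_root_.HydrodynamicLimit (the re-typed, packing-guarded conjunct BY NAME); the SUPPORT statements
TemperedCollisions, CollisionMoments (existence and temperedness of the infinite dynamics on local
limits, N-uniform distortion budget) and EntropyPerParticle (non-degeneracy of the class) are the
foreseen finite-N inputs consumed inside the proofs of U1/U2, and GibbsStatesURegularSlaved
witnesses that U2's class is inhabited. DECIDING THEOREM (rev 35, route-repair 2026-08-16 after the
Statement re-type p126922; sorry-free, axioms propext/Classical.choice/Quot.sound, planner
Sketch.closes), CRUX-ONLY as the gate requires — its five hypotheses are exactly the route's five
crux items and the target is NOT assumed: `theorem closes : URegularLimitsSlaved → URigiditySlaved →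
GaussianTails → GronwallUInBand → EntropyMethodTransferInBand → _root_.HydrodynamicLimit := fun h₁
h₂ h₃ hG hT => hT (hG h₁ h₂ h₃)`; the packing guard of the new conjunct is SUPPLIED BY THE TARGET
ITSELF (RelEntropyVanishingInBand carries the Statement's guard clause verbatim, so the transfer
threads it through with the same η₀, σ₀ — nothing is routed through HydrodynamicLimit.of_unguarded
and no over-strong unguarded claim remains in the spine). The Assembly item records the same chain
with the two glue steps discharged: URegularLimitsSlaved → URigiditySlaved → GaussianTails →
_root_.HydrodynamicLimit (stmt-14646; Sketch.assembly_of_glue).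

Rationale: WHY THIS LINE. OllaVaradhanYau1993 (Thm 2.1, §1 p. 525) add noise for one purpose — to classify
translation-invariant stationary states of finite specific
entropy as Gibbs mixtures — and the printed counterexamples to that classification (ideal gas, hard
rods: BoltzmannHypothesisBarrier) are exactly
the systems with NO expanding directions; for d ≥ 2 hard balls every orbit is completely hyperbolic
(SimanyiSzasz1999) and the Hopf chain is what
proves the Boltzmann–Sinai hypothesis at finite N (Simanyi2013). The line imports smooth ergodic
theory (SRB/u-Gibbs states PesinSinai1982,
LedrappierYoung1985; their spatially extended uniqueness theory BricmontKupiainen1996,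
KellerLiverani2009; Pesin theory with singularities
KatokEtAl1986) into the OVY architecture: pose the Boltzmann hypothesis in the regularity class the
flow propagates (a.c. unstable conditionals),
prove that evolved smooth laws cannot leave it (U1) and classify inside it by an infinite-volume
Ledrappier–Young/Hopf argument in which
translation invariance replaces transitivity (U2), the statistical-mechanics half being
Georgii1979-type equivalence of ensembles. Versus the
routes on file: RelEntropyErgodic (0779) asks the classification for ALL finite-entropy states,
ChaoticMixing asks N-uniform RATES,
VanishingNoise keeps noise; this route asks no rate and no noise, only absolute continuity along the
one structure hard balls provably have, and
it files the N-uniform collision statistics (typed) that any such limit theory needs; since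
2026-08-16 it also files the large-velocity a-priori bound of the entropy method as its own crux
(GaussianTails). Negatives index (12 entries 2026-08-16): none of this route's statements or
near-restatements.

RANKED CRUXES. Ranked: #2 URegularLimitsSlaved (U1, INHERITANCE; TYPED 2026-08-16 over the landed D5
functor Literature.Dynamics.Billiards.slavedUnstablePlaques, stmt-13991: ∀ profiles ∃ σ₀ ∀ σ < σ₀ ∀
Φ ∀ T₀ > 0 ∀ μ, IsOVYLimitState σ a₀ θ₀ u₀ T₀ Φ μ → IsProbabilityMeasure μ ∧ IsTranslationInvariant
μ ∧ density μ < ⊤ ∧ kineticEnergyDensity μ < ⊤ ∧ ∃ Ψ : InfiniteHardSphereFlow (Fin 3) 1,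
Ψ.IsEquilibriumFlow ∧ Ψ.IsTranslationCovariant ∧ Ψ.IsAEDefined μ ∧ Ψ.IsStationary μ ∧ (∃ δ > 0, ∀ᵐ ω
∂μ, ∀ p ∈ ω, ∀ a, (collisionCluster 1 ↑ω (Ψ.traj ω) a (a+δ) p).Finite) ∧ (slavedUnstablePlaques 1
Ψ).IsURegular μ) — every OVY limit state of the evolved local-Gibbs law (σ < σ₀, uniform zoom, no
Euler data) is a translation-invariant state of finite density/energy, stationary for an
equilibrium, translation-covariant infinite flow with Sinai short-window clusters (exactly the pins
U2 consumes; Sketch.gibbsMixture_of_limit checks the hand-over), and u-regular = a.c. conditionals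
on the CONTACT-SLAVED window plaques of D5 (why it might fail: no growth lemma with N-uniform
constants exists even for N discs — singularity complexity grows with N, BalintEtAl2002; slaved
window plaques condition on unbounded backward data of the exterior and are unstable manifolds of
the exterior-driven window system, not slices of true leaves (refuter R5 on 13991), so LY85
inheritance does not port verbatim; the cluster pin off equilibrium needs cluster-size tails along
the evolved law and low density of EVERY component (R2); sources ChernovDolgopyat2009,
SinaiChernov1987, KatokEtAl1986, OllaVaradhanYau1993 §4, StenlundYoungZhang2013). #3 URigiditySlaved
(U2, THIRD repair; TYPED 2026-08-16 = the attacked 13896 signature with infiniteUnstablePlaques ↦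
slavedUnstablePlaques, Sketch.uRigiditySlavedSk_iff = Iff.rfl, stmt-13988): ∃ η₀ > 0 ∀ Φ,
Φ.IsEquilibriumFlow → Φ.IsTranslationCovariant → ∀ μ, IsProbabilityMeasure μ →
IsTranslationInvariant μ → Φ.IsAEDefined μ → Φ.IsStationary μ → (Sinai short-window clusters a.s.) →
(joint space–time ergodicity) → 0 < density μ → density μ < η₀ → kineticEnergyDensity μ < ⊤ →
(slavedUnstablePlaques 1 Φ).IsURegular μ → IsHardSphereGibbsMixture 1 μ — at packing in (0, η₀)
every translation-invariant, stationary, jointly ergodic, u-regular state of finite energy of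
infinite hard spheres in d = 3 under a pinned flow with Sinai short-window clusters
(DobrushinSinaiSukhov1989 §4.1 / Sinai1974) is a mixture of g_{z,u,β}. Repair history: URigidity
9711 (η₀ inert: convex class) → URigidityR 13912 (all-windows finite clusters: empty class) →
URigidityR2 13896 (vacuous over D4: ghost recoils of the recorded-movie exterior put the recorded
orbit on a discontinuity at every exterior contact, plaques μH^{3k}-null, AttackReport13896.md /
Vacuity.lean) → URigiditySlaved over D5's contact-slaved functor (why it might fail: window plaques
for nested windows are not nested and not semi-invariant under Φ_t, so the leafwise Hopf argument
must run on leaf-null classes; su-accessibility is local in particles and the joint-invariant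
σ-algebra must be generated by the conserved densities — an extensive non-local invariant would
break it; inhabited only if GibbsStatesURegularSlaved holds (Fubini for a Hölder, non-foliated
plaque field — a fourth vacuity there closes the route `exhausted`); sources LedrappierYoung1985,
SimanyiSzasz1999, GurevichSuhov1976, Georgii1979, KellerLiverani2009, ChernovDolgopyat2009). Next,
the two GLUE steps of the deciding theorem, badged CRUX by the retriage of 2026-08-16 under the gate
rule that only crux items may be hypotheses of `closes` (ledger rank 9; both unproved): #8
GronwallUInBand (crux; the in-band 1:1 restate, route-repair 2026-08-16 after the Statement re-type
p126922, of GronwallU stmt-14511, itself typed from the informal 9719; 14511 ⇒ it,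
Sketch.gronwallUInBand_of_old): `URegularLimitsSlaved → URigiditySlaved → GaussianTails →
RelEntropyVanishingInBand` — OVY93 §3–5 with the noise removed, the true kinetic energy kept and the
Euler solution confined to the packing band ρ_t(x)σ³ < η₀ (η₀ the prover's choice inside the
analyticity radius of the virial EOS, so a_t = a(ρ_t, θ_t, σ) exists and the local-Gibbs LD bounds
hold along the solution): entropy production with collision bookkeeping, NY03 Chebyshev truncation
of the cubic current paid by #7, bad blocks by the local-Gibbs LD bound, one/two-block through U1's
class, DESCENT of stationarity / cluster pin / u-regularity to joint-ergodic components, U2 on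
components of density below its microscopic threshold, virial/EOS and reference concentration
(contents of 0782/0768/0767); the item that makes the guarded target reachable (why it might fail:
the relative-entropy architecture has never been run for a deterministic flow with hard-core CONTACT
currents — the virial term is a singular contact functional; the descent over non-invariant slaved
plaques has no template; microscopic components denser than U2's threshold still need bad-block
bounds — the macroscopic packing guard does not remove them; sources OllaVaradhanYau1993,
NachtergaeleYau2003, KipnisLandim1999, Yau1991). #9 EntropyMethodTransferInBand (crux by the
hypotheses rule; the in-band 1:1 restate 2026-08-16 of EntropyMethodTransfer stmt-9240, which
Theorems.uGibbsSRBRigidity_entropyMethodTransfer_proof proved against the OLD unguarded abbrev —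
after the re-type that proof needs the one-line patch `HydrodynamicLimit.of_unguarded (…)`,
Sketch.entropyMethodTransfer_still; same signature as the sibling dock stmt-17397; PROVABLE NOW,
Sketch.entropyMethodTransferInBand_proof rc 0): RelEntropyVanishingInBand →
`_root_.HydrodynamicLimit` (the re-typed guarded conjunct BY NAME) by the entropy inequality μ(A) ≤
(log 2 + H(μ|λ))/log(1 + 1/λ(A)) (fact Literature.Probability.Entropy.KipnisLandim1999_A1_8_2; tree
form Theorems.tendstoHydroFieldsAt_of_klDiv) with λ(A) ≤ C e^(−(N+1)/C) and H = o(N), lawAt = map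
(flow t), the guard threaded through with the same η₀ and σ₀ (why it might fail: only by a typing
slip between the guard clause of the target and of the Statement — they are verbatim equal; sources
KipnisLandim1999, OllaVaradhanYau1993). #0 RelEntropyVanishingInBand (TARGET; the in-band 1:1
restate 2026-08-16 of the shared stmt-0766 after the Statement re-type p126922 — 0766 verbatim with
the Statement's guard clause at the Statement's position and `∃ η₀ : ℝ, 0 < η₀ ∧` prefixed, the
canonical guarded signature stmt-17396 of the sibling entropy routes; 0766 ⇒ it,
Sketch.relEntropyVanishingInBand_of_old): Yau's relative-entropy form of the GUARDED limit — ∃ η₀ >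
0 ∀ profiles ∃ σ₀ ∀ σ < σ₀ ∀ classical hs-Euler solutions on [0,T) with ρ_t(x)σ³ < η₀ on [0,T) × 𝕋³
∀ flows, the local Gibbs laws are probability measures and, given the LLN at t = 0, for every t < T
there is an activity profile a_t whose local Gibbs law concentrates exponentially around (ρ, ρu,
E)(t) and H(f^N_t | localGibbs(a_t, u_t, θ_t))/(N+1) → 0; DERIVED here by #8 (why it might fail:
entropy production ≥ cN before the first shock for some smooth DILUTE data — kills every entropy
route; or U1 fails and local limits leave the u-regular class; an implosion/DenseExcursion witness
against the unguarded 0766 no longer bears on it; sources OllaVaradhanYau1993, Yau1991, Spohn1991).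
SUPPORTS — retriaged 2026-08-16 from cruxes #4–#6 (D-0019 'lemmas you foresee': the N-UNIFORM
finite-N inputs to the PROOFS of U1/U2, not hypotheses of `closes`; provers of U1 attach them with
--supports; statements unchanged, ledger ranks 4–6): TemperedCollisions (stmt-9391; tempered
singularities: local-Gibbs expectation of Σ_collisions ε_N/|w_n| ≤ C(1+t)(N+1)^(4/3), O(1) per
collision as under the equilibrium flux; risk: the evolved contact density piles up on near-grazing
pairs, invisible to entropy; KatokEtAl1986, BalintEtAl2002, ChernovDolgopyat2009),
EntropyPerParticle (stmt-9392; KS entropy rate under the equilibrium Gibbs law ≥ c(N+1)^(4/3) = c′ ×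
collisions per unit time, N-uniform — teeth of the class; Wojtkowski1988 has only ~√N; may be known,
Chernov2000 acq-02322), CollisionMoments (stmt-9393; Σ_i E[K_i(t)²] ≤ C(1+t)²(N+1)^(5/3) —
Alexander-regularity / cluster input; risk: exponentially many collisions of n-ball clusters,
BuragoIvanov2020, BuragoFerlegerKononenko1998); and the two sanity supports
GibbsStatesURegularSlaved (stmt-13992, TYPED: dilute drift-0 Gibbs states are u-regular for
slavedUnstablePlaques under equilibrium flows — SANITY of D5, the witness that U2's class is
inhabited; to be attacked FIRST per refuter g47-0) and FiniteNSanity (stmt-10940: finite N,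
flow-invariant u-Gibbs laws on a shell are ≪ surface measure given Liouville ergodicity mod
translations — the Hopf half of Simanyi2013, the named fact simanyi_hardBall_ergodic NOT assumed).

TWO-LAYER PLAN. U1 ⇐ UpperVolumeLemma → KiferYoungUpper → InfiniteVolumeLY → U1 (card
pesin-defect-prices-u-regularity; k = 3). U2 ⇐ LocalMicrocanonical (stationary +
translation-invariant + u-regular ⇒ conditional law of a
window given exterior and local N, P, E is microcanonical: unstable holonomy from u-regularity,
stable holonomy by reversibility, local
su-accessibility of finite clusters SinaiChernov1987/SimanyiSzasz1999) → CanonicalToGibbs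
(translation-invariant canonical-Gibbs states of the
dilute hard-sphere gas are mixtures of g_{z,u,β}: Georgii1979-type equivalence of ensembles at the
level of specifications) → U2 (k = 2).
GronwallUInBand ⇐ EntropyProductionHS (hard-sphere collision bookkeeping of step 1, in the packing
band) → OneBlockU (steps 3–4 incl. the descent to joint-ergodic components) → GronwallUInBand (k =
2), the large-velocity input being the separate crux GaussianTails since 2026-08-16.
TemperedCollisions ⇐ EquilibriumFluxIdentity (flux formula under the invariant Gibbs law, provable)
→ ContactDensityBound (two-particle contact density of f_t ≤ C × equilibrium, N-uniform) →
TemperedCollisions (k = 2). Nothing here is filed now.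

KILL CRITERIA. A translation-invariant, stationary, jointly space–time ergodic, L′-u-regular
NON-Gibbs state of infinite hard spheres of arbitrarily small positive
density with Sinai short-window clusters (¬URigiditySlaved) closes the route
`refuted:URigiditySlaved` (and kills RelEntropyErgodic's 0779 a fortiori). Renderings of the posited
functor have been re-posed twice (D2 → D4 → D5) and that budget is spent: a FOURTH
vacuity/degeneracy verdict against D5 that is not a formalisation slip of the definer (the
contact-slaved object itself
empties or trivialises the u-regular class, or GibbsStatesURegularSlaved is refuted for it) closes
the route `exhausted` — the posited object cannot be rendered. ¬TemperedCollisions or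
¬CollisionMoments by super-polynomial growth in
N forces a PIVOT, not a close: U1 must then be re-posed on Chernov homogeneity strips / patch-local
plaques (restate URegularLimitsSlaved with
"u-regular on a countable union of plaques of summable weights"); a refutation showing the evolved
law's contact density concentrates on grazing
configurations at a rate growing with N kills U1 outright → close `refuted:URegularLimitsSlaved`.
¬EntropyPerParticle (entropy per collision → 0 along
N → ∞ at fixed σ) empties the u-regular class of content → close unless the refutation is a
formalisation artefact (then restate). RelEntropyVanishingInBand refuted (entropy production ≥ cN
before shocks INSIDE the packing band) or GaussianTails refuted INSIDE the smooth regime (velocity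
concentration before the shock) closes this and every relative-entropy route with the true kinetic
energy (VanishingNoise, ChaoticMixing); a counterexample to Gaussian tails only past the Euler
horizon does not touch #7 as guarded, and an implosion / dense-excursion witness against the
UNGUARDED 0766 (the loophole the Statement re-type closed) refutes nothing wanted here.
GibbsErgodicity (0779) proved elsewhere moots U1/U2; UniformLocalMixing (ChaoticMixing) proved
elsewhere supersedes GronwallUInBand's ergodic input.

NOT DECOMPOSED YET. Every item is now typed (12 decls, 0 informal; the infinite-volume objects D1–D5
have landed). Deliberately left for glued splits: the precise plaque class of U1 (log-Hölder
densities vs. homogeneity strips) until TemperedCollisions/CollisionMoments report; the five-field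
ergodic decomposition and the leafwise Hopf step on leaf-null classes inside U2 (slaved window
plaques are not nested across windows nor semi-invariant under Φ_t — a driven particle made dynamic
breaks convergence generically); inside the typed glue GronwallUInBand its foreseen children:
hard-sphere entropy-production bookkeeping, the Cesàro/convexity bookkeeping passing u-regularity to
OVY's averaged limit points, the DESCENT of u-regularity, stationarity and the a.s. short-window
cluster pin to the joint space–time ergodic components on which U2 is applied, and the
virial/EOS/reference-concentration inputs (contents of 0782/0768/0767); the large-velocity input is
no longer conceded inside GronwallUInBand but is the ranked crux GaussianTails; constants σ₀, η₀ are
not tracked (cluster-expansion radius; the conjunct's packing threshold η₀ is the prover's choice).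
Foreseen glued split of GronwallUInBand (k = 2, planner Sketch.lean rc 0, 2026-08-16):
GronwallUInBand ⇐ Descent (U1 → U2 → LimitStatesGibbs: every OVY limit state is a mixture of
hard-sphere Gibbs states g_{z,u,β}, z ≥ 0 — typed over IsOVYLimitState / IsHardSphereGibbs with no
plaque vocabulary) → OVYGronwallInBand (LimitStatesGibbs → GaussianTails →
RelEntropyVanishingInBand); not filed until a crux closes. GaussianTails (#7) is deliberately left
UNGUARDED (a hypothesis of closes may be stronger than needed; velocity tails do not see the packing
band, and for each t < T the classical solution is bounded so c < 1/(2 max θ_t) is available) —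
restate it in band only if a refuter exhibits a dense-excursion artefact.

CHEAPEST FALSIFIER. (i) LOOKUP: is an N-linear lower bound h_N ≥ c·N·ν for the KS entropy of N hard
balls at fixed small packing already in print (Chernov 2000
"Entropy values and entropy bounds", doi:10.1007/978-3-662-04062-1_6, paywalled here: acq-02322;
Sinai–Chernov 1982 space-time entropy)? If yes
EntropyPerParticle is `known` → support. Wojtkowski1988 pp. 133–134 (read) says his bound is ~√N and
does NOT give positivity of the entropy per
particle. (ii) TWO-BODY COMPUTATION (by hand): under the equilibrium collision flux the normal
relative speed s = |w_n|
has density ∝ s ds at 0, so E[s^(−a)] < ∞ iff a < 2 — TemperedCollisions (a = 1) is an identity at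
equilibrium and its content is purely
non-equilibrium/N-uniform; but the naive per-collision DISTORTION of plaque densities (∝ 1/cos²φ)
has a log-divergent first moment (∫ tan φ dφ), so
U1 "with log-Hölder densities on plaques of uniform size" is false as naively stated and must be
posed with homogeneity strips (ChernovDolgopyat2009 growth lemmas). (iii) d = 2 versions of #4–#6
are the first arena: if N-uniformity fails already for discs, retire the line. (iv) #7 is explicit
at t = 0 and at global equilibrium (finite iff c < 1/(2 max θ)): a refutation must be dynamical and
pre-shock.

NUMBERS. Scaling (macroscopic units, N+1 spheres of diameter ε_N = σ(N+1)^(−1/3) on 𝕋³): collision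
rate per particle ν_N ≍ σ²√θ (N+1)^(1/3); total
collisions in [0,t] ≍ (N+1)^(4/3); per-particle count K_i ≍ (N+1)^(1/3), so Σ_i K_i² ≍ (N+1)^(5/3);
expected Σλ⁺ per unit time ≍ (N+1)^(4/3) log(1/σ³) = KS entropy by the Pesin formula (finite N).
Known: h_N > 0 for each N
(Sinai; SinaiChernov1987), lim h_N/N exists at small density (Sinai–Chernov 1982, cited in
Wojtkowski1988 p. 133); Wojtkowski1988 lower bound ≍ √N only. Flux measure: P(|w_n| < δ) ∝ δ².
Collision
combinatorics: ≤ (C n^(3/2))^(n²) collisions for n balls in free space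
(BuragoFerlegerKononenko1998), ≥ exponentially many realisable
(BuragoIvanov2020). SRB template: invariant + a.c. unstable conditionals ⇔ Pesin formula
(LedrappierYoung1985 Thm A). Velocity tails: E exp(c|v|²) = (1−2cθ)^(−3/2)e^{c|u|²/(1−2cθ)} under a
drifted Maxwellian, finite iff c < 1/(2θ); NY Gronwall factor e^{CMT} vs truncation error e^{−cM²}.
Items at open 10, after the 2026-08-15 repairs 11 (cruxes 5); after the 2026-08-16 route-choice
repair (+ crux GaussianTails 14415, GronwallU 9719 → typed 14511, U1/U2/sanity typed by
set-signature): 12 active items ≤ 15 — target, assembly, 6 cruxes (#2 U1, #3 U2, #4–#6 N-uniform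
inputs, #7 GaussianTails), 4 supports (GronwallU, GibbsStatesURegularSlaved, FiniteNSanity,
EntropyMethodTransfer); the target was auto-cruxed rank 0 by the layer-invariant lint (7 crux
items); deciding theorem over the 7 cruxes + EntropyMethodTransfer. After the rbadge retriage and
the 2026-08-16 statement re-type repair: 12 active items — target RelEntropyVanishingInBand (#0),
Assembly (#1), cruxes U1 (#2), U2 (#3), GaussianTails (#7), GronwallUInBand (#9),
EntropyMethodTransferInBand (#9), supports TemperedCollisions, EntropyPerParticle, CollisionMoments,
GibbsStatesURegularSlaved, FiniteNSanity; `closes` over the five cruxes.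

DEFINITION REQUESTS. All five have LANDED: D1 `InfiniteHardSphereFlow`
(Literature/Analysis/FluidPDE: Alexander's a.s. flow as a hypothesis structure over
PointConfig(ℝ³×ℝ³); IsAEDefined / IsStationary / IsEquilibriumFlow / IsTranslationCovariant,
collisionCluster; facts nonempty/unique, Alexander1976); D2 `URegularState`
(Literature/Dynamics/Billiards: PlaqueFamily, IsURegular with smul/add/bind/map_equiv,
HasACCondMeasures, finite-N plaques and IsUGibbs); D3 the hard-sphere Gibbs statics
(IsHardSphereGibbs, IsHardSphereGibbsMixture, density, kineticEnergyDensity, IsOVYLimitState;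
Ruelle1969 §3.4, Georgii1979); D4 `infiniteUnstablePlaques` (exterior held to its recorded movie;
PlaqueSanity / PlaqueTeeth predicates) — DEGENERATE by ghost recoils (crux attack on 13896), kept as
the record; D5 `slavedUnstablePlaques` (SlavedUnstablePlaques + …NoGhost + …Teeth): D4's carrier
with a CONTACT-SLAVED exterior — exterior particles fly freely, take their recorded
exterior–exterior impulses on the clock and respond elastically at ACTUAL contacts with window
particles, so the window dynamics is continuous at the recorded orbit; acceptance lemmas (C)
consistency, (L) locality, (N) no atoms, (T) teeth, (G) no ghost recoil proved; (S) SANITY is the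
route support GibbsStatesURegularSlaved. U1, U2 and the sanity support are typed over D5
(2026-08-16); design notes D4-design.md / D5-design.md are evidence on the definition items and on
URigiditySlaved.

Novelty: Searches (2026-08-15): `lit frontier AtomisticToContinuum --since 2020` (30 rows; only
deterministic-hydrodynamics hit CanestrariLiveraniOlla2026,
no SRB/u-Gibbs × hydrodynamic-limit paper); `lit bridges AtomisticToContinuum --cross any` (30 rows,
none ergodic-theoretic); `lit search --source
crossref "Wojtkowski measure theoretic entropy system of hard spheres"` (→ Wojtkowski1988, READ pp.
133–134: entropy-per-particle positivity not
established); `… "Chernov entropy values entropy bounds hard ball"` (→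
doi:10.1007/978-3-662-04062-1_6, paywalled, acq-02322); `… "Burago Ivanov
exponentially many collisions"` (→ BuragoIvanov2020); `lit galaxy search "entropy of the system of
hard spheres" --star all` (3 rows: LNM 1486
reference list, ICM90, one convex-billiard arXiv — nothing on N-uniformity); OpenAlex budget
exhausted (HTTP 429) this session; the card's own
searches (Keller–Liverani, Ledrappier–Young, Gurevich–Suhov, barrier files, 117 cards) stand; ledger
negatives (0).
Nearest prior art found: LedrappierYoung1985 (doi:10.2307/1971328) + PesinSinai1982
(finite-dimensional u-Gibbs/SRB rigidity); BricmontKupiainen1996,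
KellerLiverani2009 (unique SRB state for infinite lattices of weakly coupled hyperbolic maps, incl.
"map lattices coupled by collisions");
OllaVaradhanYau1993 Thm 2.1 / LiveraniOlla1996 Thm 1.2 / FritzFunakiLebowitz1994 (classification
WITH noise); Simanyi2013 (finite-N Hopf
machinery); Wojtkowski1988 (entropy of hard spheres, √N).
Delta: nobody in the searched  [refs: 10.1007/978-3-662-04062-1_6, 10.2307/1971328, doi:10.1007/978-3-662-04062-1_6, doi:10.2307/1971328, CanestrariLiveraniOlla2026, Wojtkowski1988, BuragoIvanov2020, LedrappierYoung1985, PesinSinai1982, BricmontKupiainen1996, KellerLiverani2009, OllaVaradhanYau1993, LiveraniOlla1996, FritzFunakiLebowitz1994, Simanyi2013]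

Barriers (technique_class: u-gibbs srb-rigidity hopf-argument relative-entropy): - technique_class: u-gibbs srb-rigidity hopf-argument relative-entropy
- Literature.Barriers.AtomisticToContinuum.BoltzmannHypothesisBarrier: met head-on and evaded by
proof in a smaller class: its formal kernel (ideal gas: stationary states indexed by arbitrary
velocity laws; hard rods) has no expanding directions, so u-regularity is vacuous there and
URigidity is stated only for d = 3 colliding hard spheres at packing < η₀ where Σλ⁺ > 0
(EntropyPerParticle is the quantitative form of "collisions present").
- Literature.Barriers.AtomisticToContinuum.MacroErgodicityBarrier: same missing input on the
diffusive scale for chains; its sector-condition kernel is irrelevant at Euler scaling (no Dirichlet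
form); oscillator chains have no hyperbolicity, consistent with the line's logic (it claims nothing
there).
- Literature.Barriers.AtomisticToContinuum.HighMomentumCutoffBarrier: bites downstream in GronwallU
(cubic energy current with true KE); shared with 0781, which must be re-posed with
polynomial/truncated moments (refuter flag) — conceded, not evaded by this line's mechanism.
- Literature.Barriers.AtomisticToContinuum.HighMomentumCutoffBarrierNarrow: it does not evade it;
the bet is a NEW A-PRIORI INPUT — the N-uniform collision statistics of this route
(CollisionMoments, TemperedCollisions) plus polynomial/truncated control of the cubic velocity
moments along f_t (0781 re-posed) in place of the exponential moments of p|p|²/2 that Maxwellian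
references lack; conceded as Gronwa

History (route lifecycle, newest last):
- 2026-08-15T23:38:06Z · rev 15: dropped stmt-AtomisticToContinuum-13989 — planner slip: stmt-13989 is an accidental DUPLICATE filing of URigiditySlaved (identical text to stmt-13988, filed seconds earlier); keep 13988 (planner-rrefute-AtomisticToContinuum-UGibbsSRB-cd4d3c42-0)
- 2026-08-15T23:40:29Z · rev 17: dropped stmt-AtomisticToContinuum-13896, stmt-AtomisticToContinuum-13798, stmt-AtomisticToContinuum-13945 — route-repair (payload refuted-misstated, crux attack gen-1 2026-08-15T23:15Z on stmt-13896 URigidityR2; evidence AttackReport13896.md / W.lean / Vacuity.lean / (planner-rrefute-AtomisticToContinuum-UGibbsSRB-cd4d3c42-0)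
- 2026-08-15T23:44:29Z · rev 19: restated Assembly (stmt-AtomisticToContinuum-9394) — route-repair (rground, ground-failed): Assembly (stmt-9394) was the tautology RelEntropyVanishing → EntropyMethodTransfer → HydrodynamicLimit, flagged ground.tr (planner-rground-AtomisticToContinuum-UGibbsSRBR-09594704-0)
- 2026-08-16T03:29:45Z · rev 21: restated GronwallU (stmt-AtomisticToContinuum-9719) — route-choice repair (target-unreachable, option (a)), step 3/3: GronwallU (stmt-9719, informal support) restated 1:1 as the TYPED GLUE URegularLimitsSlaved → UR (planner-rchoice-AtomisticToContinuum-UGibbsSRB-15d726b4-0)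
- 2026-08-16T03:43:38Z · AUTO-CRUX (edit): RelEntropyVanishing — hypotheses of the deciding theorem that nothing in the route derives are cruxes (planner-rbadge-AtomisticToContinuum-UGibbsSRBR-09594704-0)
- 2026-08-16T04:15:36Z · rev 33: restated Assembly (stmt-AtomisticToContinuum-13995) — rbadge: Assembly restated to primary cruxes → Statement (U1 → U2 → GaussianTails → HydrodynamicLimit) = the crux-only closes with its two glue hypotheses (Gronw (planner-rbadge-AtomisticToContinuum-UGibbsSRBR-09594704-0)
- 2026-08-16T23:31:25Z · rev 35: restated RelEntropyVanishing (stmt-AtomisticToContinuum-0766), GronwallU (stmt-AtomisticToContinuum-14511), EntropyMethodTransfer (stmt-AtomisticToContinuum-9240 proved) — route-repair (statement-revised, p126922 retype hydro2): `closes` re-elaborated over the IN-BAND spine. RelEntropyVanishing (0766) / Gronwal (planner-rrepair-AtomisticToContinuum-UGibbsSRB-9482b246-0)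
- 2026-08-24T00:19:01Z · DORMANT — reconciler: no traction for 6.4 d (last activity item-evidence-added at 2026-08-17T14:51:42Z); parked, not closed — `ledger route dormant route-AtomisticToConti (operator:999:1576360)

sub-problem: HydrodynamicLimit · status: dormant · opened planner-plancard-AtomisticToContinuum-Hydrody-14bc9e05-0 2026-08-15T13:56:47Z · rev 35 · ledger route-AtomisticToContinuum-UGibbsSRBRigidity
GENERATED by the gate from the ledger (D-0016/17). Provers cite these decls: `theorem foo : Summit.AtomisticToContinuum.HydrodynamicLimit.Theses.UGibbsSRBRigidity.<Decl> := …` in Summits/AtomisticToContinuum/HydrodynamicLimit/Theorems/<Name>.lean.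
-/

namespace Summit.AtomisticToContinuum.HydrodynamicLimit.Theses.UGibbsSRBRigidity

open scoped BigOperators Topology Manifold Classical MeasureTheory ProbabilityTheory Matrix InnerProductSpace ComplexConjugate ContinuousMap Real NNReal ENNReal
open Filter Set Function TopologicalSpace MeasureTheory

attribute [summit_statement] _root_.HydrodynamicLimit

/-- item stmt-AtomisticToContinuum-17396 · target · rank 0 · open · by planner
why it might fail: OVY93 Thm 2.1 holds only WITH noise; deterministically an extensive non-Gibbs invariant structure of dilute local limits would carry wrong currents even inside the packing band; or entropy production ≥ cN before the first shock for some smooth dilute data.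
sources: OllaVaradhanYau1993, Yau1991, Spohn1991, LiveraniOlla1996, KipnisLandim1999
[target] PACKING-GUARDED X_RE — the shared Yau-form target stmt-AtomisticToContinuum-0766 made to
match the RE-TYPED conjunct (Statement retype p126922, 2026-08-16: `_root_.HydrodynamicLimit` is now
the packing-guarded limit, ∃ η₀ outermost, guard ∀ t ∈ [0,T) ∀ x, ρ_t(x)σ³ < η₀ after the solution
hypothesis): there is η₀ > 0 (prover-chosen) such that for all continuous positive profiles ∃ σ₀ ∀
0<σ<σ₀ ∀ T ∀ classical hs-Euler solutions (ρ,u,θ) on [0,T) WHOSE LOCAL PACKING STAYS BELOW η₀ ∀ flow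
families Φ: the initial local Gibbs laws are probability measures and, if their empirical fields
converge at t = 0, then ∀ t < T ∃ activity profile a_t such that the reference local Gibbs law (a_t,
u_t, θ_t) is a probability measure whose density/momentum/energy fields concentrate exponentially (≤
C e^{-(N+1)/C}) around (ρ, ρu, E)(t) and klDiv(lawAt Φ_N (localGibbs a₀ u₀ θ₀) t ‖ localGibbs a_t
u_t θ_t)/(N+1) → 0. CANONICAL FORM: 0766 verbatim with the Statement's guard clause inserted at the
Statement's position and `∃ η₀ : ℝ, 0 < η₀ ∧` prefixed — sibling Yau-family routes re-targeting
after the retype should attach to THIS signature (dedup). 0766 ⇒ this (take η₀ := 1 and ignore the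
guard; Ske -/
@[route_item "route-AtomisticToContinuum-UGibbsSRBRigidity"]
def RelEntropyVanishingInBand : Prop :=
  ∃ η₀ : ℝ, 0 < η₀ ∧ ∀ (a₀ θ₀ : Literature.MathematicalPhysics.KineticTheory.T3 → ℝ) (u₀ : Literature.MathematicalPhysics.KineticTheory.T3 → Literature.MathematicalPhysics.KineticTheory.V3), Continuous a₀ → Continuous θ₀ → Continuous u₀ → (∀ x, 0 < a₀ x) → (∀ x, 0 < θ₀ x) → ∃ σ₀ : ℝ, 0 < σ₀ ∧ ∀ σ : ℝ, 0 < σ → σ < σ₀ → ∀ (T : ℝ) (ρ θ : ℝ → Literature.MathematicalPhysics.KineticTheory.T3 → ℝ) (u : ℝ → Literature.MathematicalPhysics.KineticTheory.T3 → Literature.MathematicalPhysics.KineticTheory.V3), Literature.MathematicalPhysics.KineticTheory.IsHardSphereEulerSolution σ T ρ u θ → (∀ t ∈ Set.Ico 0 T, ∀ x, ρ t x * σ ^ 3 < η₀) → ∀ Φ : (N : ℕ) → Literature.Analysis.FluidPDE.HardSphereFlow (Literature.Analysis.FluidPDE.Torus.geometry (Fin 3)) (Literature.MathematicalPhysics.KineticTheory.hsDiameter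 σ N) (N + 1), (∀ N, MeasureTheory.IsProbabilityMeasure (Literature.MathematicalPhysics.KineticTheory.localGibbsLaw σ a₀ u₀ θ₀ N (Φ N))) ∧ (Literature.MathematicalPhysics.KineticTheory.TendstoHydroFieldsAt (fun N => Literature.MathematicalPhysics.KineticTheory.localGibbsLaw σ a₀ u₀ θ₀ N (Φ N)) Φ ρ u θ 0 → ∀ t ∈ Set.Ico 0 T, ∃ a : Literature.MathematicalPhysics.KineticTheory.T3 → ℝ, (∀ N, MeasureTheory.IsProbabilityMeasure (Literature.MathematicalPhysics.KineticTheory.localGibbsLaw σ a (u t) (θ t) N (Φ N))) ∧ (∀ χ : Literature.MathematicalPhysics.KineticTheory.T3 → ℝ, Continuous χ → ∀ δ : ℝ, 0 < δ → ∃ C : ℝ, 0 < C ∧ ∀ N : ℕ, Literature.MathematicalPhysics.KineticTheory.localGibbsLaw σ a (u t) (θ t) N (Φ N) {z | δ < |Literature.MathematicalPhysics.KineticTheory.empiricalDensityField z χ - ∫ x, χ x * ρ t x|} ≤ ENNReal.ofReal (C * Real.exp (-(C⁻¹ * (N + 1)))) ∧ Literature.MathematicalPhysics.KineticTheory.localGibbsLaw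 σ a (u t) (θ t) N (Φ N) {z | δ < ‖Literature.MathematicalPhysics.KineticTheory.empiricalMomentumField z χ - ∫ x, (χ x * ρ t x) • u t x‖} ≤ ENNReal.ofReal (C * Real.exp (-(C⁻¹ * (N + 1)))) ∧ Literature.MathematicalPhysics.KineticTheory.localGibbsLaw σ a (u t) (θ t) N (Φ N) {z | δ < |Literature.MathematicalPhysics.KineticTheory.empiricalEnergyField z χ - ∫ x, χ x * Literature.MathematicalPhysics.KineticTheory.totalEnergyDensity (ρ t x) (u t x) (θ t x)|} ≤ ENNReal.ofReal (C * Real.exp (-(C⁻¹ * (N + 1))))) ∧ Filter.Tendsto (fun N : ℕ => InformationTheory.klDiv ((Φ N).lawAt (Literature.MathematicalPhysics.KineticTheory.localGibbsLaw σ a₀ u₀ θ₀ N (Φ N)) t) (Literature.MathematicalPhysics.KineticTheory.localGibbsLaw σ a (u t) (θ t) N (Φ N)) / ((N : ENNReal) + 1)) Filter.atTop (nhds 0))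

/-- item stmt-AtomisticToContinuum-13991 · crux · rank 2 · open · by planner
why it might fail: No growth lemma with N-uniform constants even for N discs (singularity complexity grows with N, BalintEtAl2002); slaved plaques condition on unbounded backward exterior data, so leafwise densities of f^N_t may converge to a singular limit; the cluster pin off equilibrium needs cluster-size tails.
sources: OllaVaradhanYau1993, LedrappierYoung1985, PesinSinai1982, KatokEtAl1986, SinaiChernov1987, ChernovDolgopyat2009
[crux] U-REGULAR OVY LIMIT STATES — U1, INHERITANCE: URegularLimitsSlaved (card
pesin-defect-u-gibbs-rigidity; replaces URegularLimitsR stmt-AtomisticToContinuum-13798, whose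
clause (iv) — u-regularity for the landed D4 functor infiniteUnstablePlaques — is FALSE for every
positive-density limit state by the crux attack gen-1 on 13896 (ghost-recoil degeneracy: no
probability law with recurrent collisions is D4-u-regular); the functor is re-posed as D5
defn-SlavedUnstablePlaques, contact-slaved exterior, planner D5-design.md; lineage 5478 → 9710
(Euler clause misstated) → 13798 → this). STATEMENT: for all continuous profiles a₀, θ₀ > 0, u₀ on
𝕋³ there is σ₀ > 0 such that for 0 < σ < σ₀, every family Φ = (Φ_N) of hard-sphere flows (N+1
spheres of diameter ε_N = σ(N+1)^(−1/3) on 𝕋³), every T₀ > 0 and every OVY LIMIT STATE μ (vague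
cluster point along N → ∞ of the space–time averaged blown-up laws around a UNIFORM zoom point,
OllaVaradhanYau1993 (4.1); tree notion IsOVYLimitState) satisfies: (i) μ is a translation-invariant
probability law on PointConfig(ℝ³×ℝ³); (v) density μ < ⊤ and kinetic-energy density < ⊤; (ii) there
EXISTS an infinite hard-sphere flow Φ∞ (diameter 1) that is an eq -/
@[route_item "route-AtomisticToContinuum-UGibbsSRBRigidity", crux]
def URegularLimitsSlaved : Prop :=
  ∀ (a₀ θ₀ : Literature.MathematicalPhysics.KineticTheory.T3 → ℝ) (u₀ : Literature.MathematicalPhysics.KineticTheory.T3 → Literature.MathematicalPhysics.KineticTheory.V3), Continuous a₀ → Continuous θ₀ → Continuous u₀ → (∀ x, 0 < a₀ x) → (∀ x, 0 < θ₀ x) → ∃ σ₀ : ℝ, 0 < σ₀ ∧ ∀ σ : ℝ, 0 < σ → σ < σ₀ → ∀ (Φ : (N : ℕ) → Literature.Analysis.FluidPDE.HardSphereFlow (Literature.Analysis.FluidPDE.Torus.geometry (Fin 3)) (Literature.MathematicalPhysics.KineticTheory.hsDiameter σ N) (N + 1)) (T₀ : ℝ), 0 < T₀ → ∀ μ : Measure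 (Literature.Analysis.FunctionSpaces.PointConfig (EuclideanSpace ℝ (Fin 3) × EuclideanSpace ℝ (Fin 3))), Literature.MathematicalPhysics.KineticTheory.IsOVYLimitState σ a₀ θ₀ u₀ T₀ Φ μ → IsProbabilityMeasure μ ∧ Literature.Analysis.FluidPDE.IsTranslationInvariant μ ∧ Literature.MathematicalPhysics.KineticTheory.PointProcess.density μ < ⊤ ∧ Literature.MathematicalPhysics.KineticTheory.kineticEnergyDensity μ < ⊤ ∧ ∃ Ψ : Literature.Analysis.FluidPDE.InfiniteHardSphereFlow (Fin 3) 1, Ψ.IsEquilibriumFlow ∧ Ψ.IsTranslationCovariant ∧ Ψ.IsAEDefined μ ∧ Ψ.IsStationary μ ∧ (∃ δ : ℝ, 0 < δ ∧ ∀ᵐ (ω : Literature.Analysis.FunctionSpaces.PointConfig (EuclideanSpace ℝ (Fin 3) × EuclideanSpace ℝ (Fin 3))) ∂μ, ∀ p ∈ (ω : Set (EuclideanSpace ℝ (Fin 3) × EuclideanSpace ℝ (Fin 3))), ∀ a : ℝ, (Literature.Analysis.FluidPDE.collisionCluster 1 (ω : Set (EuclideanSpace ℝ (Fin 3) × EuclideanSpace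 ℝ (Fin 3))) (Ψ.traj ω) a (a + δ) p).Finite) ∧ (Literature.Dynamics.Billiards.slavedUnstablePlaques 1 Ψ).IsURegular μ

/-- item stmt-AtomisticToContinuum-13988 · crux · rank 3 · open · by planner
why it might fail: Slaved window plaques are neither nested across windows nor semi-invariant under Φ_t (a driven particle made dynamic breaks convergence): the Hopf step must run on leaf-null classes, no template in print; an extensive non-local invariant of the joint action (GurevichSuhov1976) breaks accessibility.
sources: LedrappierYoung1985, PesinSinai1982, KellerLiverani2009, SinaiChernov1987, SimanyiSzasz1999, Georgii1979
[crux] U-GIBBS RIGIDITY IN INFINITE VOLUME — U2, THIRD REPAIR: URigiditySlaved (card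
pesin-defect-u-gibbs-rigidity; replaces URigidityR2 stmt-AtomisticToContinuum-13896,
refuted-MISSTATED by crux attack gen-1 2026-08-15T23:15Z: with the landed D4 functor
infiniteUnstablePlaques hypothesis (e) is UNSATISFIABLE — exterior held to the recorded movie incl.
clock-triggered recoils off window particles ⇒ late-arriving window particles miss their partners ⇒
recorded orbit on a discontinuity at every exterior contact ⇒ plaques μH^{3k}-null a.e. ⇒ (e) forces
μ = 0 (Vacuity.lean) ⇒ class (a)–(e) empty, U2 vacuously true; the route's kill criteria make a
degenerate rendering of L a re-posing of the DEFINITION: D5 defn-SlavedUnstablePlaques,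
contact-slaved exterior, planner D5-design.md; lineage 5572 → 9711 (η₀ inert) → 13912 (all-windows
clusters) → 13896 (ghost recoils) → this). STATEMENT (verbatim 13896 with L ↦ L′): there is η₀ > 0
such that for every infinite hard-sphere flow Φ on PointConfig(ℝ³×ℝ³) (diameter 1) that is an
equilibrium flow and translation covariant, every probability law μ that is (a) translation
invariant; (b′) Φ-a.e. defined, Φ-stationary, with SINAI SHORT-WINDOW CLUSTE -/
@[route_item "route-AtomisticToContinuum-UGibbsSRBRigidity", crux]
def URigiditySlaved : Prop :=
  ∃ η₀ : ℝ≥0∞, 0 < η₀ ∧ ∀ Φ : Literature.Analysis.FluidPDE.InfiniteHardSphereFlow (Fin 3) 1, Φ.IsEquilibriumFlow → Φ.IsTranslationCovariant → ∀ μ : Measure (Literature.Analysis.FunctionSpaces.PointConfig (EuclideanSpace ℝ (Fin 3) × EuclideanSpace ℝ (Fin 3))), IsProbabilityMeasure μ → Literature.Analysis.FluidPDE.IsTranslationInvariant μ → Φ.IsAEDefined μ → Φ.IsStationary μ → (∃ δ : ℝ, 0 < δ ∧ ∀ᵐ (ω : Literature.Analysis.FunctionSpaces.PointConfig (EuclideanSpace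 ℝ (Fin 3) × EuclideanSpace ℝ (Fin 3))) ∂μ, ∀ p ∈ (ω : Set (EuclideanSpace ℝ (Fin 3) × EuclideanSpace ℝ (Fin 3))), ∀ a : ℝ, (Literature.Analysis.FluidPDE.collisionCluster 1 (ω : Set (EuclideanSpace ℝ (Fin 3) × EuclideanSpace ℝ (Fin 3))) (Φ.traj ω) a (a + δ) p).Finite) → (∀ A : Set (Literature.Analysis.FunctionSpaces.PointConfig (EuclideanSpace ℝ (Fin 3) × EuclideanSpace ℝ (Fin 3))), MeasurableSet A → (∀ a : EuclideanSpace ℝ (Fin 3), Literature.Analysis.FunctionSpaces.PointConfig.translate ((a, 0) : EuclideanSpace ℝ (Fin 3) × EuclideanSpace ℝ (Fin 3)) ⁻¹' A = A) → (∀ t : ℝ, Φ.flow t ⁻¹' A =ᵐ[μ] A) → μ A = 0 ∨ μ Aᶜ = 0) → 0 < Literature.MathematicalPhysics.KineticTheory.PointProcess.density μ → Literature.MathematicalPhysics.KineticTheory.PointProcess.density μ < η₀ → Literature.MathematicalPhysics.KineticTheory.kineticEnergyDensity μ < ⊤ → (Literature.Dynamics.Billiards.slavedUnstablePlaques 1 Φ).IsURegular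 μ → Literature.MathematicalPhysics.KineticTheory.IsHardSphereGibbsMixture 1 μ

/-- item stmt-AtomisticToContinuum-14415 · crux · rank 7 · open · by planner
why it might fail: Energy + O(N) entropy vs global Gibbs let the flow load energy ≫ θ_max on a fraction ~M⁻² of spheres with O(1) probability before the shock (cost O(N)), making E[(N+1)⁻¹Σexp(c|v|²)] unbounded for every c>0; no N-uniform Povzner/maximum principle for hard spheres is known.
sources: NachtergaeleYau2003, OllaVaradhanYau1993, Varadhan1993EntropyMethods, Literature.Barriers.AtomisticToContinuum.HighMomentumCutoffBarrierNarrow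
[crux] GAUSSIAN VELOCITY TAILS ALONG THE TRUE EVOLUTION, N-UNIFORM, IN THE SMOOTH REGIME (the
large-velocity input of the relative entropy method with the TRUE kinetic energy |v|²/2 =
Nachtergaele–Yau's high-momentum cutoff Assumption II.1 transcribed to hard spheres, restricted to
times below the classical Euler horizon; the a-priori input conceded so far inside GronwallU and
flagged by retriage as carried by no active item; it is the third antecedent of the typed glue
GronwallU : URegularLimitsSlaved → URigiditySlaved → GaussianTails → RelEntropyVanishing).
STATEMENT: for all continuous profiles a₀, θ₀ > 0, u₀ there is σ₀ > 0 such that for 0 < σ < σ₀,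
every classical hs-Euler solution (ρ,u,θ) on [0,T), every family of hard-sphere flows Φ_N (N+1
spheres of diameter σ(N+1)^(-1/3) on 𝕋³) whose local Gibbs law localGibbsLaw σ a₀ u₀ θ₀ satisfies
the LLN towards (ρ,ρu,E)(0) at t = 0, and every t < T, there are c > 0, C < ∞ and N₀ with
E_{λ^N}[(N+1)⁻¹ Σ_i exp(c |v_i(Φ_N(s) z)|²)] ≤ C for all N ≥ N₀ and all s ∈ [0,t]
(Literature.Barriers.AtomisticToContinuum.expVelocityMoment; = the body of the open hypothesis
HighMomentumCutoff σ of the barrier file, GUARDED by the smooth solution so th -/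
@[route_item "route-AtomisticToContinuum-UGibbsSRBRigidity", crux]
def GaussianTails : Prop :=
  ∀ (a₀ θ₀ : Literature.MathematicalPhysics.KineticTheory.T3 → ℝ) (u₀ : Literature.MathematicalPhysics.KineticTheory.T3 → Literature.MathematicalPhysics.KineticTheory.V3), Continuous a₀ → Continuous θ₀ → Continuous u₀ → (∀ x, 0 < a₀ x) → (∀ x, 0 < θ₀ x) → ∃ σ₀ : ℝ, 0 < σ₀ ∧ ∀ σ : ℝ, 0 < σ → σ < σ₀ → ∀ (T : ℝ) (ρ θ : ℝ → Literature.MathematicalPhysics.KineticTheory.T3 → ℝ) (u : ℝ → Literature.MathematicalPhysics.KineticTheory.T3 → Literature.MathematicalPhysics.KineticTheory.V3), Literature.MathematicalPhysics.KineticTheory.IsHardSphereEulerSolution σ T ρ u θ → ∀ Φ : (N : ℕ) → Literature.Analysis.FluidPDE.HardSphereFlow (Literature.Analysis.FluidPDE.Torus.geometry (Fin 3)) (Literature.MathematicalPhysics.KineticTheory.hsDiameter σ N) (N + 1), Literature.MathematicalPhysics.KineticTheory.TendstoHydroFieldsAt (fun N => Literature.MathematicalPhysics.KineticTheory.localGibbsLaw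 σ a₀ u₀ θ₀ N (Φ N)) Φ ρ u θ 0 → ∀ t ∈ Set.Ico 0 T, ∃ c : ℝ, 0 < c ∧ ∃ C : ENNReal, C < ⊤ ∧ ∃ N₀ : ℕ, ∀ N : ℕ, N₀ ≤ N → ∀ s ∈ Set.Icc 0 t, (∫⁻ z, Literature.Barriers.AtomisticToContinuum.expVelocityMoment c ((Φ N).flow s z) ∂(Literature.MathematicalPhysics.KineticTheory.localGibbsLaw σ a₀ u₀ θ₀ N (Φ N))) ≤ C

/-- item stmt-AtomisticToContinuum-17397 · crux · rank 9 · open · by planner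
why it might fail: Provable now (entropy inequality KipnisLandim1999 A1.8.2 + the reference law's exponential LLN, guard threaded through with the same η₀, σ₀; Sketch rc 0); it can fail only by a typing slip between the guard clause of the target and of the Statement — they are verbatim equal.
sources: KipnisLandim1999, OllaVaradhanYau1993, Yau1991
[support] GUARDED ENTROPY DOCK (packing-guarded twin of the closed glue item
stmt-AtomisticToContinuum-0769 EntropyToFields): RelEntropyVanishingInBand → the re-typed conjunct
`_root_.HydrodynamicLimit`. Proof (8 lines, checked rc 0 in the planner's Sketch.lean, attached as
evidence): take η₀ and σ₀ from the hypothesis; for σ < σ₀, a guarded classical solution, Φ,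
convergence at t = 0 and t < T, obtain ⟨a_t, probability, concentration, klDiv → 0⟩ and apply the
tree lemma Summit.AtomisticToContinuum.HydrodynamicLimit.Theorems.tendstoHydroFieldsAt_of_klDiv
(Theorems/TwoClocksEntropyToHydro.lean: entropy inequality for events μ(A)·L ≤ KL(μ‖ν) + (e^L −
1)ν(A), exponential concentration of the reference, transfer along the measurable flow). Becomes the
last hypothesis of `closes` (replacing EntropyToFields + HydrodynamicLimit.of_unguarded) once crux
#4 is restated to conclude RelEntropyVanishingInBand. [deps: RelEntropyVanishingInBand] [difficulty:
S] -/
@[route_item "route-AtomisticToContinuum-UGibbsSRBRigidity", crux]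
def EntropyMethodTransferInBand : Prop :=
  RelEntropyVanishingInBand → _root_.HydrodynamicLimit

/-- item stmt-AtomisticToContinuum-17738 · crux · rank 9 · open · by planner
why it might fail: OVY93 §3–5 has never been run for a deterministic flow with hard-core CONTACT currents (singular virial functional); the descent of u-regularity/stationarity to joint-ergodic components over non-invariant slaved plaques has no template; dense microscopic components still need bad-block bounds.
sources: OllaVaradhanYau1993, NachtergaeleYau2003, KipnisLandim1999, Yau1991, LedrappierYoung1985
[crux] RELATIVE-ENTROPY GRONWALL CONSUMING ONLY DYNAMICAL LOCAL LIMITS, IN THE PACKING BAND — the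
typed glue that makes the GUARDED target reachable (route-repair 2026-08-16 after the Statement
re-type p126922: 1:1 restate of GronwallU stmt-AtomisticToContinuum-14511 with the conclusion
RelEntropyVanishing ↦ RelEntropyVanishingInBand; 14511 ⇒ this, planner Sketch.gronwallUInBand_of_old
rc 0). STATEMENT: URegularLimitsSlaved → URigiditySlaved → GaussianTails →
RelEntropyVanishingInBand. CONTENT (Olla–Varadhan–Yau 1993 §3–5 with the noise removed, the true
kinetic energy kept, and the classical Euler solution confined to the packing band ρ_t(x)σ³ < η₀, η₀
the prover's choice inside the analyticity radius of the virial EOS so that the activity a_t =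
a(ρ_t, θ_t, σ) exists and the local-Gibbs large-deviation bounds hold along the solution): with
f^N_t = lawAt Φ_N (localGibbsLaw σ a₀ u₀ θ₀) t and ψ^N_t the local Gibbs law with parameters
(a(ρ_t,σ), u_t, θ_t): (1) entropy-production bound d/dt H(f_t|ψ_t) ≤ −∫ f_t (∂_t + L) log ψ_t for
the deterministic hard-sphere flow on 𝕋³ (Liouville + collision bookkeeping: the jump of log ψ_t at
a contact is the collisional part of the currents); (2) -/
@[route_item "route-AtomisticToContinuum-UGibbsSRBRigidity", crux]
def GronwallUInBand : Prop :=
  URegularLimitsSlaved → URigiditySlaved → GaussianTails → RelEntropyVanishingInBand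

/-- item stmt-AtomisticToContinuum-9391 · support · rank 4 · open · by planner
why it might fail: An identity at equilibrium (collision flux ∝ |w_n| dw_n ⇒ E[1/|w_n|] < ∞ per collision), but 1/|w_n| has no 2nd/exponential flux moment, so H(f_t|Gibbs) = O(N) transfers nothing: the evolved local-Gibbs contact density may pile up on near-grazing pairs (Liouville-null), breaking N-uniformity.
sources: KatokEtAl1986, Chernov1997, ChernovDolgopyat2009, BalintEtAl2002, SinaiChernov1987
[crux] TEMPERED COLLISIONS, N-UNIFORM (the "tempered singularities" input of Pesin/Katok–Strelcyn
theory for the local limit states, card U1's first failure mode): for continuous local-Gibbs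
profiles there is σ₀ such that for σ < σ₀ there is C with, for every macroscopic t ≥ 0, all N and
all hard-sphere flows Φ of N+1 spheres of diameter ε_N = σ(N+1)^(-1/3) on 𝕋³: the expectation under
the local Gibbs law of the sum over the collisions of the orbit in [0, t] of ε_N/|⟨x_i − x_j, v_i −
v_j⟩| (the inverse normal relative speed 1/|w_n| of the colliding pair) is ≤ C (1 + t) (N+1)^(4/3) —
i.e. O(1) per collision, linear in time, as under the equilibrium flux measure (density ∝ |w_n|
d|w_n| near 0). [difficulty: L] -/
@[route_item "route-AtomisticToContinuum-UGibbsSRBRigidity"]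
def TemperedCollisions : Prop :=
  ∀ (a₀ θ₀ : Literature.MathematicalPhysics.KineticTheory.T3 → ℝ) (u₀ : Literature.MathematicalPhysics.KineticTheory.T3 → Literature.MathematicalPhysics.KineticTheory.V3), Continuous a₀ → Continuous θ₀ → Continuous u₀ → (∀ x, 0 < a₀ x) → (∀ x, 0 < θ₀ x) → ∃ σ₀ : ℝ, 0 < σ₀ ∧ ∀ σ : ℝ, 0 < σ → σ < σ₀ → ∃ C : ℝ, ∀ t : ℝ, 0 ≤ t → ∀ (N : ℕ) (Φ : Literature.Analysis.FluidPDE.HardSphereFlow (Literature.Analysis.FluidPDE.Torus.geometry (Fin 3)) (Literature.MathematicalPhysics.KineticTheory.hsDiameter σ N) (N + 1)), ∫⁻ z, ENNReal.ofReal (∑ᶠ τ ∈ Literature.Analysis.FluidPDE.collisionTimes (Literature.Analysis.FluidPDE.Torus.geometry (Fin 3)) (Literature.MathematicalPhysics.KineticTheory.hsDiameter σ N) (fun s => Φ.flow s z) ∩ Set.Icc 0 t, ∑ i : Fin (N + 1), ∑ j ∈ Finset.univ.erase i, (Literature.Analysis.FluidPDE.contactSet (Literature.Analysis.FluidPDE.Torus.geometry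 (Fin 3)) (N + 1) (Literature.MathematicalPhysics.KineticTheory.hsDiameter σ N) i j).indicator (fun y : Literature.Analysis.FluidPDE.Config (N + 1) (Fin 3) Literature.MathematicalPhysics.KineticTheory.T3 => Literature.MathematicalPhysics.KineticTheory.hsDiameter σ N / |inner ℝ ((Literature.Analysis.FluidPDE.Torus.geometry (Fin 3)).sepVec (y i).1 (y j).1) ((y i).2 - (y j).2)|) (Φ.flow τ z)) ∂(Literature.MathematicalPhysics.KineticTheory.localGibbsLaw σ a₀ u₀ θ₀ N Φ) ≤ ENNReal.ofReal (C * (1 + t) * ((N : ℝ) + 1) ^ (4 / 3 : ℝ))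

/-- item stmt-AtomisticToContinuum-9392 · support · rank 5 · open · by planner
why it might fail: Print has: lim h_N/N exists (SinaiChernov1986; Zbl 0575.28014: no positivity), h_N ≳ √N·rate (Wojtkowski1988), kinetic-theory heuristic h/N = ν(−ln πnσ³+0.562) (doi:10.1103/physreve.56.5272); an N-uniform h ≥ cNν needs per-particle locality of expansion across others' collisions — U1's wall.
sources: Wojtkowski1988, SinaiChernov1986, Chernov2000, Chernov1997, doi:10.1103/physreve.56.5272, LedrappierYoung1985
[crux] POSITIVE DYNAMICAL ENTROPY PER PARTICLE PER COLLISION, N-UNIFORM (teeth of the u-regular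
class; the specific entropy of Sinai–Chernov's infinite equilibrium dynamics is positive): there is
σ₀ such that for σ < σ₀ there is c > 0 with, for all N ≥ 1 (at least two spheres; one free particle
has zero entropy) and all flows Φ, a finite measurable partition P of phase space whose
Kolmogorov–Sinai entropy rate under the equilibrium Gibbs law (activity 1, drift 0, temperature 1)
for the macroscopic time-one map Φ₁ h(Φ₁, P) := lim_n n⁻¹ H(P ∨ Φ₁⁻¹P ∨ … ∨ Φ₁^(−(n−1))P) EXISTS (as
it does for an invariant law, by subadditivity) and is ≥ c (N+1)^(4/3) = c' × (number of collisions
per unit macroscopic time). [difficulty: L] -/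
@[route_item "route-AtomisticToContinuum-UGibbsSRBRigidity"]
def EntropyPerParticle : Prop :=
  ∃ σ₀ : ℝ, 0 < σ₀ ∧ ∀ σ : ℝ, 0 < σ → σ < σ₀ → ∃ c : ℝ, 0 < c ∧ ∀ (N : ℕ) (Φ : Literature.Analysis.FluidPDE.HardSphereFlow (Literature.Analysis.FluidPDE.Torus.geometry (Fin 3)) (Literature.MathematicalPhysics.KineticTheory.hsDiameter σ N) (N + 1)), 1 ≤ N → ∃ (k : ℕ) (P : Fin k → Set (Literature.Analysis.FluidPDE.Config (N + 1) (Fin 3) Literature.MathematicalPhysics.KineticTheory.T3)), (∀ i, MeasurableSet (P i)) ∧ Pairwise (Function.onFun Disjoint P) ∧ (⋃ i, P i) = Set.univ ∧ ∃ h : ℝ, c * ((N : ℝ) + 1) ^ (4 / 3 : ℝ) ≤ h ∧ Filter.Tendsto (fun n : ℕ => (n : ℝ)⁻¹ * ∑ w : Fin n → Fin k, -((Literature.MathematicalPhysics.KineticTheory.localGibbsLaw σ (fun _ => 1) (fun _ => 0) (fun _ => 1) N Φ).real (⋂ m : Fin n, (Φ.flow 1)^[m.val] ⁻¹' P (w m))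 * Real.log ((Literature.MathematicalPhysics.KineticTheory.localGibbsLaw σ (fun _ => 1) (fun _ => 0) (fun _ => 1) N Φ).real (⋂ m : Fin n, (Φ.flow 1)^[m.val] ⁻¹' P (w m))))) Filter.atTop (nhds h)

/-- item stmt-AtomisticToContinuum-9393 · support · rank 6 · open · by planner
why it might fail: n-ball clusters realise ≥ 2^⌊n/2⌋ collisions (BuragoIvanov2020 Thm 1.1; BFK98: ≤ (32n^{2/3})^{n²}) and the measure of many-collision data is their open Question 2; exp. moments of K_i plausibly infinite ⇒ no entropy transfer; N-uniform 2nd moments along the non-equilibrium law need unknown tails.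
sources: BuragoFerlegerKononenko1998, BuragoIvanov2020, Alexander1976, GallagherSaintRaymondTexier2013, Chernov1997
[crux] N-UNIFORM SECOND MOMENTS OF PER-PARTICLE COLLISION COUNTS (Alexander-regularity and
singularity complexity of local limits, card U1's second failure mode): for continuous local-Gibbs
profiles there is σ₀ such that for σ < σ₀ there is C with, for every t ≥ 0, all N and Φ: Σ_i
E[K_i(t)²] ≤ C (1 + t)² (N+1)^(5/3) under the local Gibbs law, where K_i(t) is the number of times
in [0, t] at which particle i is in contact with some other particle (≍ (N+1)^(1/3) in the mean).
[difficulty: M] -/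
@[route_item "route-AtomisticToContinuum-UGibbsSRBRigidity", crux]
def CollisionMoments : Prop :=
  ∀ (a₀ θ₀ : Literature.MathematicalPhysics.KineticTheory.T3 → ℝ) (u₀ : Literature.MathematicalPhysics.KineticTheory.T3 → Literature.MathematicalPhysics.KineticTheory.V3), Continuous a₀ → Continuous θ₀ → Continuous u₀ → (∀ x, 0 < a₀ x) → (∀ x, 0 < θ₀ x) → ∃ σ₀ : ℝ, 0 < σ₀ ∧ ∀ σ : ℝ, 0 < σ → σ < σ₀ → ∃ C : ℝ, ∀ t : ℝ, 0 ≤ t → ∀ (N : ℕ) (Φ : Literature.Analysis.FluidPDE.HardSphereFlow (Literature.Analysis.FluidPDE.Torus.geometry (Fin 3)) (Literature.MathematicalPhysics.KineticTheory.hsDiameter σ N) (N + 1)), ∫⁻ z, ∑ i : Fin (N + 1), ((Set.ncard {τ : ℝ | τ ∈ Set.Icc 0 t ∧ ∃ j : Fin (N + 1), j ≠ i ∧ Φ.flow τ z ∈ Literature.Analysis.FluidPDE.contactSet (Literature.Analysis.FluidPDE.Torus.geometry (Fin 3)) (N + 1) (Literature.MathematicalPhysics.KineticTheory.hsDiameter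 σ N) i j} : ENNReal)) ^ 2 ∂(Literature.MathematicalPhysics.KineticTheory.localGibbsLaw σ a₀ u₀ θ₀ N Φ) ≤ ENNReal.ofReal (C * (1 + t) ^ 2 * ((N : ℝ) + 1) ^ (5 / 3 : ℝ))

-- earlier FiniteNSanity (stmt-AtomisticToContinuum-10854, replaced 2026-08-15T16:30:20Z -> stmt-AtomisticToContinuum-10940): retired by None — ∀ (d N : ℕ) (ε e : ℝ) (Φ : Literature.Analysis.FluidPDE.HardSphereFlow (Literature.Analysis.FluidPDE.Torus.geometry (Fin d)) ε N), 2 ≤ d → 2 ≤ N → 0 < ε → ε < 2⁻¹ → IsConnected (Literature.MathematicalPhysics.KineticTheory.torusConfigInterior (Fin d) N ε) → 0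
-- earlier FiniteNSanity (stmt-AtomisticToContinuum-9720, replaced 2026-08-15T16:25:15Z -> stmt-AtomisticToContinuum-10854): retired by None — Literature.MathematicalPhysics.KineticTheory.simanyi_hardBall_ergodic.{0} → ∀ (d N : ℕ) (ε e : ℝ) (Φ : Literature.Analysis.FluidPDE.HardSphereFlow (Literature.Analysis.FluidPDE.Torus.geometry (Fin d)) ε N), 2 ≤ d → 2 ≤ N → 0 < ε → ε < 2⁻¹ → IsConnected (Litera
/-- item stmt-AtomisticToContinuum-10940 · support · rank 9 · open · by planner
sources: LedrappierYoung1985, KatokEtAl1986, Simanyi2013, SimanyiSzasz1999, SinaiChernov1987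
[support] FINITE-N u-GIBBS SANITY THEOREM (card U4), CONE-REPAIRED FORM, conclusion in the MEASURE
CLASS of the surface measure (route-choice repair 2026-08-15, rev 4). For d ≥ 2, N ≥ 2 unit-mass
balls of diameter 0 < ε < 1/2 on 𝕋^d with connected configuration-space interior
(torusConfigInterior), an energy e > 0 and a hard-sphere flow Φ
(Literature.Analysis.FluidPDE.HardSphereFlow (Torus.geometry (Fin d)) ε N) good shellMeasure-a.e. on
the zero-momentum energy surface Y_e (zeroMomentumEnergyShell): IF shellMeasure N ε e is ergodic
modulo translations (every measurable set invariant under all translateAll a and shellMeasure-a.e.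
invariant under every Φ_t is shellMeasure-null or conull — the explicit hypothesis introduced at rev
3 in place of the named fact simanyi_hardBall_ergodic, which discharges it in print: Simanyi2009 §1
Thm + Simanyi2013 Thm 2.1/§4), THEN every Borel probability measure μ carried by Y_e and by Φ.good,
invariant under every Φ_t and every translateAll a, and u-Gibbs for Φ (HardSphereFlow.IsUGibbs: a.c.
conditional measures on local unstable plaques, LedrappierYoung1985 Def. 1.4.2) is ABSOLUTELY
CONTINUOUS with respect to the surface measure: μ ≪ shellMeasure N -/
@[route_item "route-AtomisticToContinuum-UGibbsSRBRigidity"]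
def FiniteNSanity : Prop :=
  ∀ (d N : ℕ) (ε e : ℝ) (Φ : Literature.Analysis.FluidPDE.HardSphereFlow (Literature.Analysis.FluidPDE.Torus.geometry (Fin d)) ε N), 2 ≤ d → 2 ≤ N → 0 < ε → ε < 2⁻¹ → IsConnected (Literature.MathematicalPhysics.KineticTheory.torusConfigInterior (Fin d) N ε) → 0 < e → Literature.MathematicalPhysics.KineticTheory.shellMeasure N ε e Φ.goodᶜ = 0 → (∀ A : Set (Literature.Analysis.FluidPDE.Config N (Fin d) (UnitAddTorus (Fin d))), MeasurableSet A → (∀ a : UnitAddTorus (Fin d), Literature.MathematicalPhysics.KineticTheory.translateAll a ⁻¹' A = A) → (∀ t : ℝ, Φ.flow t ⁻¹' A =ᵐ[Literature.MathematicalPhysics.KineticTheory.shellMeasure N ε e] A) → Literature.MathematicalPhysics.KineticTheory.shellMeasure N ε e A = 0 ∨ Literature.MathematicalPhysics.KineticTheory.shellMeasure N ε e Aᶜ = 0) → ∀ (μ : MeasureTheory.Measure (Literature.Analysis.FluidPDE.Config N (Fin d) (UnitAddTorus (Fin d)))) [MeasureTheory.IsProbabilityMeasure μ], μ (Literature.MathematicalPhysics.KineticTheory.zeroMomentumEnergyShell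 N ε e)ᶜ = 0 → μ Φ.goodᶜ = 0 → (∀ t : ℝ, MeasureTheory.Measure.map (Φ.flow t) μ = μ) → (∀ a : UnitAddTorus (Fin d), MeasureTheory.Measure.map (Literature.MathematicalPhysics.KineticTheory.translateAll a) μ = μ) → Literature.Analysis.FluidPDE.HardSphereFlow.IsUGibbs Φ μ → MeasureTheory.Measure.AbsolutelyContinuous μ (Literature.MathematicalPhysics.KineticTheory.shellMeasure N ε e)

/-- item stmt-AtomisticToContinuum-13992 · support · rank 9 · open · by planner
sources: PesinSinai1982, LedrappierYoung1985, KatokEtAl1986, StenlundYoungZhang2013, LiuQian1995, ChernovDolgopyat2009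
[support] GIBBS STATES ARE u-REGULAR FOR THE CONTACT-SLAVED FUNCTOR — SANITY / NON-VACUITY OF THE
u-REGULAR CLASS: GibbsStatesURegularSlaved (replaces GibbsStatesURegular
stmt-AtomisticToContinuum-13945 = PlaqueSanity infiniteUnstablePlaques at drift 0, which is FALSE by
the crux attack gen-1 on 13896 — ghost-recoil degeneracy of D4; acceptance predicate (S) of the
re-posed definition D5 defn-SlavedUnstablePlaques filed as a route statement; the witness that
hypothesis (e) of URigiditySlaved is inhabited and the special case "global equilibrium" of
URegularLimitsSlaved). STATEMENT: there is z₀ > 0 such that for every infinite hard-sphere flow Φ on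
PointConfig(ℝ³×ℝ³) (diameter 1) that is an equilibrium flow and all 0 < z < z₀, 0 < β, every
translation-invariant hard-sphere Gibbs state g with IsHardSphereGibbs 1 z β 0 g (drift 0:
IsEquilibriumFlow pins Φ only on centred Gibbs states) is u-regular for the CONTACT-SLAVED
window-plaque functor L′ of D5: (L′ 1 Φ).IsURegular g. LEAN SHAPE: Sketch.GibbsURegularWith L′
(planner Sketch.lean rc 0) = ∃ z₀ : ℝ, 0 < z₀ ∧ ∀ Φ : InfiniteHardSphereFlow (Fin 3) 1,
Φ.IsEquilibriumFlow → ∀ z β g, 0 < z → z < z₀ → 0 < β → IsHardSphereGibbs 1 z β 0 g → -/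
@[route_item "route-AtomisticToContinuum-UGibbsSRBRigidity"]
def GibbsStatesURegularSlaved : Prop :=
  ∃ z₀ : ℝ, 0 < z₀ ∧ ∀ Φ : Literature.Analysis.FluidPDE.InfiniteHardSphereFlow (Fin 3) 1, Φ.IsEquilibriumFlow → ∀ (z β : ℝ) (g : Measure (Literature.Analysis.FunctionSpaces.PointConfig (EuclideanSpace ℝ (Fin 3) × EuclideanSpace ℝ (Fin 3)))), 0 < z → z < z₀ → 0 < β → Literature.Analysis.FluidPDE.IsHardSphereGibbs 1 z β 0 g → Literature.Analysis.FluidPDE.IsTranslationInvariant g → (Literature.Dynamics.Billiards.slavedUnstablePlaques 1 Φ).IsURegular g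

-- earlier Assembly (stmt-AtomisticToContinuum-13995, replaced 2026-08-16T04:15:36Z -> stmt-AtomisticToContinuum-14646): retired by None — TemperedCollisions → EntropyPerParticle → CollisionMoments → RelEntropyVanishing → _root_.HydrodynamicLimit
-- earlier Assembly (stmt-AtomisticToContinuum-9394, replaced 2026-08-15T23:44:29Z -> stmt-AtomisticToContinuum-13995): retired by None — RelEntropyVanishing → EntropyMethodTransfer → _root_.HydrodynamicLimit
/-- item stmt-AtomisticToContinuum-14646 · assembly · rank 1 · open · by planner
sources: KipnisLandim1999, OllaVaradhanYau1993
[assembly] The three PRIMARY cruxes imply the sub-problem Statement `_root_.HydrodynamicLimit` BY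
NAME: URegularLimitsSlaved → URigiditySlaved → GaussianTails → HydrodynamicLimit (template shape
Crux₂ → Crux₃ → Crux₇ → Statement). Proof = the two glue cruxes once landed: `fun h₁ h₂ h₃ =>
EntropyMethodTransfer_thm (GronwallU_thm h₁ h₂ h₃)`; it is NOT provable from its own antecedents (no
tautology: GronwallU and EntropyMethodTransfer are separate items, #h21_ground batteries fail —
planner RouteTest.lean), and it is exactly the content of the crux-only deciding theorem `closes :
URegularLimitsSlaved → URigiditySlaved → GaussianTails → GronwallU → EntropyMethodTransfer →
_root_.HydrodynamicLimit := fun h₁ h₂ h₃ hG hT => hT (hG h₁ h₂ h₃)` (rev 32) with its two glue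
hypotheses discharged. Replaces the interim form TemperedCollisions → EntropyPerParticle →
CollisionMoments → RelEntropyVanishing → HydrodynamicLimit (stmt-13995, rground 2026-08-15), written
while U1/U2/GronwallU were informal; TemperedCollisions / EntropyPerParticle / CollisionMoments are
now SUPPORT inputs to the proof of U1/U2 (retriage 2026-08-16) and the target is derived by
GronwallU, so neither belongs in the assemb -/
@[route_item "route-AtomisticToContinuum-UGibbsSRBRigidity"]
def Assembly : Prop :=
  URegularLimitsSlaved → URigiditySlaved → GaussianTails → _root_.HydrodynamicLimit

-- records of items no longer active in this route (dropped / restated):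
-- earlier RelEntropyVanishing (stmt-AtomisticToContinuum-0766, replaced 2026-08-16T23:31:25Z -> stmt-AtomisticToContinuum-17396): open — ∀ (a₀ θ₀ : Literature.MathematicalPhysics.KineticTheory.T3 → ℝ) (u₀ : Literature.MathematicalPhysics.KineticTheory.T3 → Literature.MathematicalPhysics.KineticTheory.V3), Continuous a₀ → Continuous θ₀ → Continuous u₀ → (∀ x, 0 < a₀ x) → (∀ x, 0 < θ₀ x) → ∃ σ₀ : ℝ, 0
-- earlier GronwallU (stmt-AtomisticToContinuum-14511, replaced 2026-08-16T23:31:25Z -> stmt-AtomisticToContinuum-17738): retired by None — URegularLimitsSlaved → URigiditySlaved → GaussianTails → RelEntropyVanishing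
-- earlier EntropyMethodTransfer (stmt-AtomisticToContinuum-9240, replaced 2026-08-16T23:31:25Z -> stmt-AtomisticToContinuum-17397): proved by Summit.AtomisticToContinuum.HydrodynamicLimit.Theorems.hydrodynamicLimit_of_relEntropyVanishing — RelEntropyVanishing → _root_.HydrodynamicLimit
-- earlier GronwallU (stmt-AtomisticToContinuum-9719, replaced 2026-08-16T03:29:45Z -> stmt-AtomisticToContinuum-14511): retired by None — [support] RELATIVE-ENTROPY GRONWALL CONSUMING ONLY DYNAMICAL LOCAL LIMITS (card U3; the route-specific form of RelEntropyErgodic stmt-0780): with f^N_t the law lawAt Φ_N (localGibbsLaw σ a₀ u₀ θ₀) t and ψ^N_t the local Gibbs law with parameters (a(ρ_t,σ), u_t, θ_t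

/-! D-0027 §2.1 — DECIDING THEOREM (planner-authored via `route open/edit --closes-file`; by planner-rrepair-AtomisticToContinuum-UGibbsSRB-9482b246-0 2026-08-16T23:31:25Z):
its hypotheses are this route's items and its conclusion the sub-problem Statement (glue_lint), and it elaborates with this file. -/

@[closes "route-AtomisticToContinuum-UGibbsSRBRigidity"] theorem closes : URegularLimitsSlaved → URigiditySlaved → GaussianTails → GronwallUInBand → EntropyMethodTransferInBand → _root_.HydrodynamicLimit := fun h₁ h₂ h₃ hG hT => hT (hG h₁ h₂ h₃)

end Summit.AtomisticToContinuum.HydrodynamicLimit.Theses.UGibbsSRBRigidity
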